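import Literature.AlgebraicTopology.SingularHomology.FiniteCoverTransfer
import Literature.AlgebraicTopology.SingularHomology.HOneProducts
import Literature.AlgebraicTopology.SingularHomology.LoopClassesSpan
import Literature.AlgebraicTopology.SingularHomology.UniversalCoefficientsField
import Literature.AlgebraicTopology.SingularHomology.RelativeCapProduct
import Mathlib.Topology.Homotopy.Lifting
import HarnessLib

/-!
# The norm of a map along a finite covering and the transfer in `H¹`

For a finite covering `p : E → B` (`IsFiniteCover p`, `FiniteCoverTransfer.lean`) and a
continuous map `F : E → G` into a commutative topological group, the **norm** (or trace, written
multiplicatively) of `F` along `p` is the continuous map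

  `N_p F : B → G`, `b ↦ ∏_{e ∈ p⁻¹(b)} F(e)`

(`IsFiniteCover.normMap`; Mumford, *Abelian Varieties*, §6 / Fulton, *Intersection Theory*,
Ex. 1.7.4, the norm of a unit along a finite flat map, here purely topologically). The main
result of this file is the degree-one cohomological identity behind "the transfer is induced by
the norm" (Hatcher, *Algebraic Topology*, §3.G: `τ^* π^* = ` multiplication by the number of
sheets; and the additivity `(f · g)_* = f_* + g_*` on `H₁` of maps into a path-connected
topological group, Lemma 3C.3 / `HOneProducts.lean`):

* `IsFiniteCover.ncard_fibre_smul_transferMap_map` — for `B` path connected, `G` a path-connected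
  commutative topological group, `F : C(E, G)` and `a ∈ H¹(G; ℚ)`:

  `d • τ(F^* a) = (N_p F)^* a` in `H¹(B; ℚ)`,

  where `d = #p⁻¹(b)` is the (constant) number of sheets and `τ = IsFiniteCover.transferMap` is
  the NORMALISED transfer of `FiniteCoverTransfer.lean` (so `d • τ` is the classical transfer).

Proof (all of it elementary covering-space theory, Hatcher §1.3, plus the Hurewicz description
of `H₁`, Hatcher Thm. 2A.1): both sides are linear in `a`, and by the universal coefficient
theorem over `ℚ` (`kroneckerPairing_injective_of_field`) and "loop classes span `H₁(B; ℚ)`"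
(`singularHomology.linearMap_ext_loopClass`) it suffices to pair both sides with the Hurewicz
class `h(γ)` of a loop `γ` at `b₀`. Replacing `γ` by a power `γ^m` multiplies both pairings by `m`;
for `m` = the order of the monodromy permutation of the finite fibre `p⁻¹(b₀)` every lift of `γ^m`
is a CLOSED loop `λ_e` at `e ∈ p⁻¹(b₀)` (`IsCoveringMap.monodromy`, Mathlib). Then, on a
representing cocycle `φ` of `a`, `⟨d • τ F^*[φ], h(γ^m)⟩ = ∑_e φ(F ∘ λ_e) = ∑_e ⟨[φ], h(F ∘ λ_e)⟩ =
⟨[φ], h(∏_e F ∘ λ_e)⟩` (Eckmann–Hilton additivity `loopClass_mul_eq_add`), and the pointwise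
product `t ↦ ∏_e F(λ_e(t))` IS the loop `N_p F ∘ γ^m`, because `e ↦ λ_e(t)` is a bijection of
`p⁻¹(b₀)` onto `p⁻¹(γ^m(t))` (uniqueness of lifts and constancy of `#p⁻¹(b)` on a connected base).

Also: `IsFiniteCover.fibre` (fibres as `Finset`s), `isLocallyConstant_ncard_fibre`,
`ncard_fibre_eq` (constancy of the number of sheets on a preconnected base, Hatcher §1.3 p. 61),
`continuous_normFun`, `card_liftsFinset` (the number of lifts of a simplex is the number of
sheets), `kroneckerPairing_π_loopClass` (`⟨[φ], h(γ)⟩ = φ(γ)`), `loopClass_npow`,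
`loopClass_finsetProd`.

Everything is proved; no named facts.

## References

* A. Hatcher, *Algebraic Topology*, CUP 2002: §1.3 Prop. 1.30, 1.34 and p. 61, 68–70 (path
  lifting, monodromy action on the fibre, number of sheets); Thm. 2A.1 (Hurewicz); §3.1 Thm. 3.2
  (universal coefficients over a field); §3.C Lemma 3C.3; §3.G p. 321 and Prop. 3G.1 (transfer).
  [HatcherAT2002]
* D. Mumford, *Abelian Varieties*, Oxford 1970, §1 (1) and §6. [MumfordAV1970]
* W. Fulton, *Intersection Theory*, 2nd ed. 1998, Ex. 1.7.4 (norm along a finite map).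
  [Fulton1998]
-/

noncomputable section

open CategoryTheory Topology

universe u v

namespace Literature.AlgebraicTopology.SingularHomology

/-! ### Paths as singular simplices: two bookkeeping lemmas -/

namespace SingularSimplex

variable {X : Type u} [TopologicalSpace X]

/-- `ofPath` only depends on the underlying function of the path. [folklore] -/
lemma ofPath_congr {x y x' y' : X} {γ : Path x y} {γ' : Path x' y'} (h : ∀ t, γ t = γ' t) :
    ofPath γ = ofPath γ' := by
  apply toContinuousMap_injective
  ext s : 1
  rw [ofPath_apply, ofPath_apply, h]

/-- The parameter of the vertex `v₀ ∈ Δ¹` is `0 ∈ [0, 1]`. [folklore] -/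
lemma toUnitInterval_vertex_zero : StdSimplex.toUnitInterval (stdSimplex.vertex 0) = 0 :=
  Subtype.ext (by
    rw [StdSimplex.coe_toUnitInterval, stdSimplex.vertex_coe, Pi.single_eq_of_ne (by decide)]
    rfl)

/-- The initial vertex of the simplex of a path is its source. [folklore] -/
lemma vertex_zero_ofPath {x y : X} (γ : Path x y) : (ofPath γ).vertex 0 = x := by
  rw [vertex, ofPath_apply, toUnitInterval_vertex_zero, γ.source]

end SingularSimplex

/-! ### Hurewicz classes: pairing with cocycles, powers, pointwise products -/

section LoopClasses

variable {R : Type v} [CommRing R] {X : Type u} [TopologicalSpace X]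

open SingularSimplex singularCochainComplex

/-- **`⟨[φ], h(γ)⟩ = φ(γ)`**: the Kronecker pairing of the class of a `1`-cocycle `φ` with the
Hurewicz class of a loop `γ` is the value of `φ` on the singular simplex of `γ`
(Hatcher 2002, §3.1 p. 191, evaluation of a cocycle on a cycle). [cite: HatcherAT2002, §3.1 p. 191 and Thm. 2A.1] -/
theorem kroneckerPairing_π_loopClass {x : X} (γ : Path x x) (φ : cocycles R R X 1) :
    kroneckerPairing R R X 1 (singularCohomology.π R R X 1 φ) (loopClass R R (1 : R) γ) =
      iCocycles R R X 1 φ (ofPath γ) := by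
  have hz : (singularChainComplex R R X).d 1 0
      (singularChainComplex.single (R := R) (ofPath γ) (1 : R)) = 0 := by
    have h := d_single_ofPath_loop R R (1 : R) γ
    rwa [show (ComplexShape.down ℕ).next 1 = 0 from ChainComplex.next_nat_succ 0] at h
  rw [loopClass, homologyCls_eq_homologyπ_cyclesMk _ _ 0 (ChainComplex.next_nat_succ 0) hz,
    kroneckerPairing_π_single {(0 : Fin 1)} (fun _ => ofPath γ) (fun _ => (1 : R)) φ _
      (by rw [Finset.sum_singleton]; exact (singularChainComplex R R X).i_cyclesMk _ _ _ _),
    Finset.sum_singleton, smul_eq_mul, mul_one]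

/-- Powers `γ^n = γ ⬝ … ⬝ γ` of a loop (`γ^0 = refl`, `γ^(n+1) = γ^n ⬝ γ`). [folklore] -/
def Path.npow {x : X} (γ : Path x x) : ℕ → Path x x
  | 0 => Path.refl x
  | n + 1 => (Path.npow γ n).trans γ

/-- `h(γ^n) = n • h(γ)` (additivity of the Hurewicz map, Hatcher Thm. 2A.1). [cite: HatcherAT2002, Thm. 2A.1] -/
theorem loopClass_npow (M : Type v) [AddCommGroup M] [Module R M] (m : M) {x : X} (γ : Path x x)
    (n : ℕ) : loopClass R M m (Path.npow γ n) = n • loopClass R M m γ := by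
  induction n with
  | zero => rw [Path.npow, loopClass_refl, zero_smul]
  | succ n ih => rw [Path.npow, loopClass_trans, ih, add_smul, one_smul]

variable {G : Type u} [TopologicalSpace G] [CommGroup G] [IsTopologicalGroup G]

/-- The pointwise product `t ↦ ∏_{i ∈ s} αᵢ(t)` of a finite family of loops in a commutative
topological group, a loop at `∏_{i ∈ s} αᵢ(0)`. [folklore] -/
def Path.finsetProd {ι : Type*} (s : Finset ι) {x : ι → G} (α : ∀ i, Path (x i) (x i)) :
    Path (∏ i ∈ s, x i) (∏ i ∈ s, x i) where
  toFun t := ∏ i ∈ s, α i t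
  continuous_toFun := continuous_finsetProd s fun i _ ↦ (α i).continuous
  source' := Finset.prod_congr rfl fun i _ ↦ (α i).source
  target' := Finset.prod_congr rfl fun i _ ↦ (α i).target

/-- Values of `Path.finsetProd`. [folklore] -/
@[simp]
lemma Path.finsetProd_apply {ι : Type*} (s : Finset ι) {x : ι → G} (α : ∀ i, Path (x i) (x i))
    (t : unitInterval) : Path.finsetProd s α t = ∏ i ∈ s, α i t :=
  rfl

/-- **`h(∏ᵢ αᵢ) = ∑ᵢ h(αᵢ)`** for the pointwise product of loops in a path-connected commutative
topological group (Eckmann–Hilton, `loopClass_mul_eq_add`, Hatcher §3.C Lemma 3C.3).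
[cite: HatcherAT2002, §3.C Lemma 3C.3] -/
theorem loopClass_finsetProd [PathConnectedSpace G] (M : Type v) [AddCommGroup M] [Module R M]
    (m : M) {ι : Type*} (s : Finset ι) {x : ι → G} (α : ∀ i, Path (x i) (x i)) :
    loopClass R M m (Path.finsetProd s α) = ∑ i ∈ s, loopClass R M m (α i) := by
  classical
  induction s using Finset.induction_on with
  | empty =>
    rw [Finset.sum_empty]
    have h : ofPath (Path.finsetProd ∅ α) = ofPath (Path.refl (1 : G)) :=
      ofPath_congr fun t ↦ by rw [Path.finsetProd_apply, Finset.prod_empty]; rfl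
    rw [loopClass_eq_of_ofPath_eq _ _ _ _ _ h, loopClass_refl]
  | insert a s ha ih =>
    rw [Finset.sum_insert ha, ← ih, ← loopClass_mul_eq_add]
    refine loopClass_eq_of_ofPath_eq _ _ _ _ _ (ofPath_congr fun t ↦ ?_)
    rw [Path.finsetProd_apply, Finset.prod_insert ha, Path.mul_apply, Path.finsetProd_apply]

end LoopClasses

namespace IsFiniteCover

variable {E B : Type u} [TopologicalSpace E] [TopologicalSpace B] {proj : C(E, B)}
  (c : IsFiniteCover proj)

/-! ### Fibres of a finite covering -/

/-- The fibre `p⁻¹(b)` of a finite covering as a `Finset`. [folklore] -/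
def fibre (b : B) : Finset E :=
  (c.finite_fibre b).toFinset

/-- Membership in the fibre. [folklore] -/
@[simp]
lemma mem_fibre {b : B} {e : E} : e ∈ c.fibre b ↔ proj e = b := by
  rw [fibre, Set.Finite.mem_toFinset, Set.mem_preimage, Set.mem_singleton_iff]

/-- The cardinality of the fibre. [folklore] -/
lemma card_fibre (b : B) : (c.fibre b).card = (proj ⁻¹' {b}).ncard := by
  rw [fibre, ← Set.ncard_eq_toFinset_card _ (c.finite_fibre b)]

include c in
/-- Fibres of a finite covering are nonempty (the projection is onto). [folklore] -/
lemma nonempty_fibre (b : B) : Nonempty (proj ⁻¹' {b}) := by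
  obtain ⟨e, he⟩ := c.surjective b
  exact ⟨⟨e, he⟩⟩

include c in
/-- **The number of sheets is locally constant** (Hatcher 2002, §1.3 p. 61: the cardinality of
`p⁻¹(x)` is locally constant over the base): over an evenly covered neighbourhood all fibres are
homeomorphic to one of them. [cite: HatcherAT2002, §1.3 p. 61] -/
theorem isLocallyConstant_ncard_fibre : IsLocallyConstant fun b ↦ (proj ⁻¹' {b}).ncard := by
  refine (IsLocallyConstant.iff_eventually_eq _).2 fun b₀ ↦ ?_
  haveI := c.nonempty_fibre b₀
  let t := (c.isCoveringMap b₀).toTrivialization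
  have hb₀ : b₀ ∈ t.baseSet := (c.isCoveringMap b₀).mem_toTrivialization_baseSet
  filter_upwards [t.open_baseSet.mem_nhds hb₀] with b hb
  rw [← Nat.card_coe_set_eq, ← Nat.card_coe_set_eq,
    Nat.card_congr (t.preimageSingletonHomeomorph hb).toEquiv,
    Nat.card_congr (t.preimageSingletonHomeomorph hb₀).toEquiv]

include c in
/-- **On a connected base all fibres have the same cardinality** (the number of sheets,
Hatcher 2002, §1.3 p. 61). [cite: HatcherAT2002, §1.3 p. 61] -/
theorem ncard_fibre_eq [PreconnectedSpace B] (b b' : B) :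
    (proj ⁻¹' {b}).ncard = (proj ⁻¹' {b'}).ncard :=
  c.isLocallyConstant_ncard_fibre.apply_eq_of_preconnectedSpace b b'

/-- `Finset` form of `ncard_fibre_eq`. [cite: HatcherAT2002, §1.3 p. 61] -/
theorem card_fibre_eq [PreconnectedSpace B] (b b' : B) : (c.fibre b).card = (c.fibre b').card := by
  rw [card_fibre, card_fibre, c.ncard_fibre_eq b b']

/-- **The number of lifts of a simplex is the number of sheets** over its initial vertex
(unique lifting, `SingularSimplex.liftsEquivFibre`). [cite: HatcherAT2002, §1.3 Prop. 1.34 and §3.G p. 321] -/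
theorem card_liftsFinset {n : ℕ} (σ : SingularSimplex B n) :
    (c.liftsFinset σ).card = (proj ⁻¹' {σ.vertex 0}).ncard := by
  rw [liftsFinset, ← Set.ncard_eq_toFinset_card _
    (SingularSimplex.finite_lifts c.isCoveringMap c.finite_fibre σ), ← Nat.card_coe_set_eq,
    ← Nat.card_coe_set_eq]
  exact Nat.card_congr (SingularSimplex.liftsEquivFibre c.isCoveringMap σ)

/-- Summing over the lifts of `σ` is summing over the fibre of its initial vertex, each point
`e` contributing the lift of `σ` starting at `e`. [cite: HatcherAT2002, §1.3 Prop. 1.34 and §3.G p. 321] -/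
theorem sum_liftsFinset_eq_sum_fibre {M : Type*} [AddCommMonoid M] {n : ℕ} (σ : SingularSimplex B n)
    [Fintype (proj ⁻¹' {σ.vertex 0})] (ψ : SingularSimplex E n → M) :
    ∑ a ∈ c.liftsFinset σ, ψ a =
      ∑ e : proj ⁻¹' {σ.vertex 0}, ψ (SingularSimplex.lift c.isCoveringMap σ e.1
        (SingularSimplex.apply_eq_of_mem_fibre e)) := by
  classical
  let ε := SingularSimplex.liftsEquivFibre c.isCoveringMap σ
  refine Finset.sum_bij' (fun a ha ↦ ε ⟨a, SingularSimplex.mem_lifts.2 (c.mem_liftsFinset.1 ha)⟩)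
    (fun e _ ↦ (ε.symm e).1) (fun _ _ ↦ Finset.mem_univ _) (fun e _ ↦ c.mem_liftsFinset.2
      (SingularSimplex.mem_lifts.1 (ε.symm e).2)) (fun a ha ↦ ?_) (fun e _ ↦ ?_) (fun a ha ↦ ?_)
  · exact congrArg Subtype.val (ε.symm_apply_apply _)
  · exact ε.apply_symm_apply e
  · exact congrArg ψ (congrArg Subtype.val (ε.symm_apply_apply
      ⟨a, SingularSimplex.mem_lifts.2 (c.mem_liftsFinset.1 ha)⟩)).symm

/-! ### The norm of a map along a finite covering -/

section Norm

variable {G : Type u} [CommMonoid G]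

/-- **The norm of `F : E → G` along the finite covering `p`**: `b ↦ ∏_{e ∈ p⁻¹(b)} F(e)`
(Mumford, *Abelian Varieties*, §6; Fulton, *Intersection Theory*, Ex. 1.7.4, written
multiplicatively and purely topologically). [cite: MumfordAV1970, §6] -/
def normFun (F : E → G) (b : B) : G :=
  ∏ e ∈ c.fibre b, F e

/-- Unfolding `normFun`. [folklore] -/
lemma normFun_apply (F : E → G) (b : B) : c.normFun F b = ∏ e ∈ c.fibre b, F e :=
  rfl

/-- Local formula: over an evenly covered neighbourhood with trivialisation `t` based at `b₀`,
`N_p F (b) = ∏_{i ∈ p⁻¹(b₀)} F(t⁻¹(b, i))`. [folklore] -/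
lemma normFun_eq_prod_symm (F : E → G) {b₀ : B} [Nonempty (proj ⁻¹' {b₀})]
    [Fintype (proj ⁻¹' {b₀})] {b : B}
    (hb : b ∈ (c.isCoveringMap b₀).toTrivialization.baseSet) :
    c.normFun F b = ∏ i : proj ⁻¹' {b₀},
      F (((c.isCoveringMap b₀).toTrivialization.preimageSingletonHomeomorph hb).symm i).1 := by
  classical
  let t := (c.isCoveringMap b₀).toTrivialization
  haveI : Fintype (proj ⁻¹' {b}) := (c.finite_fibre b).fintype
  rw [normFun_apply, Finset.prod_subtype (c.fibre b) (p := fun e ↦ e ∈ proj ⁻¹' {b})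
    (fun e ↦ by rw [mem_fibre, Set.mem_preimage, Set.mem_singleton_iff]) F]
  exact Fintype.prod_equiv (t.preimageSingletonHomeomorph hb).toEquiv _ _ fun e ↦
    congrArg F (congrArg Subtype.val ((t.preimageSingletonHomeomorph hb).symm_apply_apply e).symm)

variable [TopologicalSpace G] [ContinuousMul G]

/-- **The norm along a finite covering is continuous** (locally it is a finite product of `F`
composed with the continuous local sections of the covering). [folklore] -/
theorem continuous_normFun (F : C(E, G)) : Continuous (c.normFun F) := by
  classical
  refine continuous_iff_continuousAt.2 fun b₀ ↦ ?_
  haveI := c.nonempty_fibre b₀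
  haveI : Fintype (proj ⁻¹' {b₀}) := (c.finite_fibre b₀).fintype
  let t := (c.isCoveringMap b₀).toTrivialization
  have hb₀ : b₀ ∈ t.baseSet := (c.isCoveringMap b₀).mem_toTrivialization_baseSet
  let g : B → G := fun b ↦ ∏ i : proj ⁻¹' {b₀}, F (t.toPartialHomeomorph.symm (b, i))
  have hg : ContinuousOn g t.baseSet := by
    refine continuousOn_finsetProd _ fun i _ ↦ F.continuous.comp_continuousOn ?_
    refine t.toPartialHomeomorph.continuousOn_symm.comp (Continuous.continuousOn (by fun_prop))
      fun b hb ↦ ?_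
    rw [t.target_eq]
    exact ⟨hb, Set.mem_univ _⟩
  have heq : ∀ b ∈ t.baseSet, g b = c.normFun F b := fun b hb ↦ by
    rw [c.normFun_eq_prod_symm F hb]
    rfl
  exact (hg.continuousAt (t.open_baseSet.mem_nhds hb₀)).congr
    (Filter.eventually_of_mem (t.open_baseSet.mem_nhds hb₀) heq)

/-- **The norm of `F : E → G` along `p` as a continuous map `N_p F : C(B, G)`.**
[cite: MumfordAV1970, §6] -/
def normMap (F : C(E, G)) : C(B, G) :=
  ⟨c.normFun F, c.continuous_normFun F⟩

/-- Values of `normMap`. [folklore] -/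
@[simp]
lemma normMap_apply (F : C(E, G)) (b : B) : c.normMap F b = ∏ e ∈ c.fibre b, F e :=
  rfl

end Norm

/-! ### Lifted loops and the monodromy permutation -/

section Monodromy

variable {b₀ : B} (γ : Path b₀ b₀)

/-- The source of a loop at `b₀` lies under every point of the fibre `p⁻¹(b₀)`. [folklore] -/
lemma source_eq_apply (e : proj ⁻¹' {b₀}) : γ 0 = proj e.1 := by
  rw [γ.source]
  exact (Set.mem_singleton_iff.1 (Set.mem_preimage.1 e.2)).symm

/-- The lift `λ_e` of the loop `γ` starting at `e ∈ p⁻¹(b₀)` (Hatcher 2002, §1.3 Prop. 1.30;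
Mathlib `IsCoveringMap.liftPath`). [cite: HatcherAT2002, §1.3 Prop. 1.30] -/
def liftLoop (e : proj ⁻¹' {b₀}) : C(unitInterval, E) :=
  c.isCoveringMap.liftPath γ e.1 (source_eq_apply γ e)

/-- The lift lies over `γ`. [cite: HatcherAT2002, §1.3 Prop. 1.30] -/
lemma proj_liftLoop (e : proj ⁻¹' {b₀}) (t : unitInterval) : proj (c.liftLoop γ e t) = γ t :=
  congr_fun (c.isCoveringMap.liftPath_lifts γ e.1 (source_eq_apply γ e)) t

/-- The lift starts at `e`. [cite: HatcherAT2002, §1.3 Prop. 1.30] -/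
lemma liftLoop_zero (e : proj ⁻¹' {b₀}) : c.liftLoop γ e 0 = e.1 :=
  c.isCoveringMap.liftPath_zero γ e.1 (source_eq_apply γ e)

/-- **Uniqueness of lifts, pointwise**: two lifts of `γ` agreeing at one time are lifts from the
same starting point (Hatcher 2002, §1.3 Prop. 1.34). [cite: HatcherAT2002, §1.3 Prop. 1.34] -/
lemma liftLoop_injective (t : unitInterval) : Function.Injective fun e : proj ⁻¹' {b₀} ↦ c.liftLoop γ e t := by
  intro e e' h
  have hΛ : ⇑(c.liftLoop γ e) = ⇑(c.liftLoop γ e') :=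
    c.isCoveringMap.eq_of_comp_eq (c.liftLoop γ e).continuous (c.liftLoop γ e').continuous
      (by rw [liftLoop, liftLoop, c.isCoveringMap.liftPath_lifts, c.isCoveringMap.liftPath_lifts]) t h
  apply Subtype.ext
  rw [← c.liftLoop_zero γ e, ← c.liftLoop_zero γ e', hΛ]

/-- The end point of the lift is the monodromy image of the starting point (Mathlib
`IsCoveringMap.monodromy`, Hatcher 2002, §1.3 pp. 68–70). [cite: HatcherAT2002, §1.3 pp. 68–70] -/
lemma liftLoop_one (e : proj ⁻¹' {b₀}) :
    c.liftLoop γ e 1 = (c.isCoveringMap.monodromy (Path.Homotopic.Quotient.mk γ) e).1 :=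
  rfl

/-- The monodromy of `γ^n` is the `n`-th iterate of the monodromy of `γ`. [cite: HatcherAT2002, §1.3 pp. 68–70] -/
lemma monodromy_npow (n : ℕ) :
    c.isCoveringMap.monodromy (Path.Homotopic.Quotient.mk (Path.npow γ n)) =
      (c.isCoveringMap.monodromy (Path.Homotopic.Quotient.mk γ))^[n] := by
  induction n with
  | zero =>
    rw [Function.iterate_zero, Path.npow]
    exact c.isCoveringMap.monodromy_refl
  | succ n ih =>
    rw [Function.iterate_succ', Path.npow, Path.Homotopic.Quotient.mk_trans]
    funext e
    rw [c.isCoveringMap.monodromy_trans_apply, ih]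
    rfl

/-- **Some power of a loop lifts to closed loops at every point of the finite fibre**: the
monodromy of `γ` is a permutation of the finite set `p⁻¹(b₀)` (Hatcher 2002, §1.3 pp. 68–70),
hence of finite order `m ≥ 1`, and every lift of `γ^m` is closed. [cite: HatcherAT2002, §1.3 pp. 68–70] -/
theorem exists_npow_liftLoop_one :
    ∃ m : ℕ, 0 < m ∧ ∀ e : proj ⁻¹' {b₀}, c.liftLoop (Path.npow γ m) e 1 = e.1 := by
  haveI : Finite (proj ⁻¹' {b₀}) := (c.finite_fibre b₀).to_subtype
  let T : Equiv.Perm (proj ⁻¹' {b₀}) := Equiv.ofBijective _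
    (c.isCoveringMap.monodromy_bijective (Path.Homotopic.Quotient.mk γ))
  refine ⟨orderOf T, orderOf_pos T, fun e ↦ ?_⟩
  rw [liftLoop_one, c.monodromy_npow]
  have h : ((c.isCoveringMap.monodromy (Path.Homotopic.Quotient.mk γ))^[orderOf T]) e = e := by
    have h1 : (⇑T)^[orderOf T] e = (T ^ orderOf T) e := by rw [Equiv.Perm.coe_pow]
    rw [show (c.isCoveringMap.monodromy (Path.Homotopic.Quotient.mk γ)) = ⇑T from rfl, h1,
      pow_orderOf_eq_one, Equiv.Perm.coe_one, id_eq]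
  rw [h]

/-- A lift that closes up, as a loop at its starting point. [folklore] -/
def liftedLoop (e : proj ⁻¹' {b₀}) (h : c.liftLoop γ e 1 = e.1) : Path e.1 e.1 :=
  ⟨c.liftLoop γ e, c.liftLoop_zero γ e, h⟩

/-- Values of `liftedLoop`. [folklore] -/
@[simp]
lemma liftedLoop_apply (e : proj ⁻¹' {b₀}) (h : c.liftLoop γ e 1 = e.1) (t : unitInterval) :
    c.liftedLoop γ e h t = c.liftLoop γ e t :=
  rfl

/-- The singular simplex of the closed lift at `e` is THE lift of the simplex of `γ` at `e`.
[cite: HatcherAT2002, §1.3 Prop. 1.34] -/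
lemma lift_ofPath_eq (e : proj ⁻¹' {b₀}) (h : c.liftLoop γ e 1 = e.1)
    (he : proj e.1 = (SingularSimplex.ofPath γ).vertex 0) :
    SingularSimplex.lift c.isCoveringMap (SingularSimplex.ofPath γ) e.1 he =
      SingularSimplex.ofPath (c.liftedLoop γ e h) := by
  refine SingularSimplex.eq_of_map_eq_of_vertex_eq c.isCoveringMap ?_ ?_
  · rw [SingularSimplex.lift_map, SingularSimplex.ofPath_map]
    exact (SingularSimplex.ofPath_congr fun t ↦ (c.proj_liftLoop γ e t).symm)
  · rw [SingularSimplex.lift_vertex_zero, SingularSimplex.vertex_zero_ofPath]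

end Monodromy

/-! ### The transfer in `H¹` is induced by the norm -/

section Transfer

open SingularSimplex singularCochainComplex

/-- The transfer on representing cocycles: `τ[β] = [τ β]`. [cite: HatcherAT2002, §3.G p. 321] -/
lemma transferMap_π {R : Type v} [CommRing R] [Algebra ℚ R] (n : ℕ) (β : cocycles R R E n) :
    c.transferMap (R := R) n (singularCohomology.π R R E n β) =
      singularCohomology.π R R B n (HomologicalComplex.cyclesMap (c.transfer (R := R)) n β) := by
  change ((singularCochainComplex R R E).homologyπ n ≫
      HomologicalComplex.homologyMap c.transfer n) β =
    (HomologicalComplex.cyclesMap c.transfer n ≫ (singularCochainComplex R R B).homologyπ n) β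
  rw [HomologicalComplex.homologyπ_naturality]

/-- The cochain `τ(F^♯ φ)` evaluated on a simplex: `(1/#lifts σ) ∑_{σ̃ lifts σ} φ(F ∘ σ̃)`.
[cite: HatcherAT2002, §3.G p. 321] -/
lemma iCocycles_transfer_map_apply {R : Type v} [CommRing R] [Algebra ℚ R] {G : Type u}
    [TopologicalSpace G] (F : C(E, G)) {n : ℕ} (φ : cocycles R R G n) (σ : SingularSimplex B n) :
    iCocycles R R B n (HomologicalComplex.cyclesMap (c.transfer (R := R)) n
        (cocyclesMap R R F n φ)) σ =
      c.weight σ * ∑ a ∈ c.liftsFinset σ, iCocycles R R G n φ (a.map F) := by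
  have h : iCocycles R R B n (HomologicalComplex.cyclesMap (c.transfer (R := R)) n
      (cocyclesMap R R F n φ)) = (c.transfer (R := R)).f n (iCocycles R R E n (cocyclesMap R R F n φ)) := by
    change (HomologicalComplex.cyclesMap c.transfer n ≫ iCocycles R R B n) _ =
      (iCocycles R R E n ≫ (c.transfer (R := R)).f n) _
    rw [HomologicalComplex.cyclesMap_i]
  rw [h, transfer_f_apply, iCocycles_cocyclesMap]
  rfl

variable [PathConnectedSpace B] {G : Type u} [TopologicalSpace G] [CommGroup G]
  [IsTopologicalGroup G] (F : C(E, G))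

/-- **The pointwise product of `F` over the lifts of a loop is the norm along the loop**:
`∏_{e ∈ p⁻¹(b₀)} F(λ_e(t)) = (N_p F)(γ(t))` for the lifts `λ_e` (`e ∈ p⁻¹(b₀)`) of a path `γ`
from `b₀`, because `e ↦ λ_e(t)` is a bijection `p⁻¹(b₀) → p⁻¹(γ(t))` (injective by uniqueness
of lifts, and both fibres have the number of sheets as cardinality). [cite: HatcherAT2002, §1.3 Prop. 1.34 and p. 61] -/
theorem prod_apply_liftLoop {b₀ : B} (γ : Path b₀ b₀) [Fintype (proj ⁻¹' {b₀})] (t : unitInterval) :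
    ∏ e : proj ⁻¹' {b₀}, F (c.liftLoop γ e t) = c.normMap F (γ t) := by
  classical
  have himage : (Finset.univ.image fun e : proj ⁻¹' {b₀} ↦ c.liftLoop γ e t) = c.fibre (γ t) := by
    refine Finset.eq_of_subset_of_card_le (fun x hx ↦ ?_) ?_
    · obtain ⟨e, -, rfl⟩ := Finset.mem_image.1 hx
      exact c.mem_fibre.2 (c.proj_liftLoop γ e t)
    · rw [Finset.card_image_of_injective _ (c.liftLoop_injective γ t), Finset.card_univ,
        ← Nat.card_eq_fintype_card, Nat.card_coe_set_eq, c.card_fibre, c.ncard_fibre_eq (γ t) b₀]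
  rw [normMap_apply, ← himage, Finset.prod_image fun e _ e' _ h ↦ c.liftLoop_injective γ t h]

variable [PathConnectedSpace G]

/-- **The transfer in `H¹` is induced by the norm** (rational coefficients). For a finite covering
`p : E → B` of a path-connected space with `d` sheets, a continuous map `F : E → G` into a
path-connected commutative topological group and `a ∈ H¹(G; ℚ)`:

  `d • τ(F^* a) = (N_p F)^* a` in `H¹(B; ℚ)`,

`τ` the normalised transfer `IsFiniteCover.transferMap` (Hatcher 2002, §3.G) and
`N_p F = ∏_{p(e) = b} F(e)` the norm of `F` along `p` (`normMap`). See the module docstring for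
the proof (universal coefficients over `ℚ`, loop classes span `H₁`, closed lifts of a power of the
loop, Eckmann–Hilton additivity of `H₁` in a topological group). [cite: HatcherAT2002, §3.G p. 321, Thm. 2A.1, §3.C Lemma 3C.3] -/
theorem ncard_fibre_smul_transferMap_map (b : B) (a : singularCohomology ℚ ℚ G 1) :
    ((proj ⁻¹' {b}).ncard : ℚ) • c.transferMap (R := ℚ) 1 (singularCohomology.map ℚ ℚ F 1 a) =
      singularCohomology.map ℚ ℚ (c.normMap F) 1 a := by
  classical
  -- Step 1: pair with `H₁(B; ℚ)`; it suffices to test against loop classes at a base point.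
  apply kroneckerPairing_injective_of_field ℚ B 1
  obtain ⟨b₀⟩ := (inferInstance : Nonempty B)
  rw [c.ncard_fibre_eq b b₀]
  haveI : Fintype (proj ⁻¹' {b₀}) := (c.finite_fibre b₀).fintype
  have hd : ((proj ⁻¹' {b₀}).ncard : ℚ) ≠ 0 := by
    rw [← c.card_fibre]
    exact Nat.cast_ne_zero.2 (Finset.card_pos.2 ⟨_, c.mem_fibre.2
      (Set.mem_singleton_iff.1 (c.nonempty_fibre b₀).some.2)⟩).ne'
  refine singularHomology.linearMap_ext_loopClass b₀ fun γ ↦ ?_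
  -- Step 2: replace `γ` by a power `γ'` all of whose lifts are closed.
  obtain ⟨m, hm, hcl⟩ := c.exists_npow_liftLoop_one γ
  have hmq : (m : ℚ) ≠ 0 := Nat.cast_ne_zero.2 hm.ne'
  have key : ∀ (x y : singularCohomology ℚ ℚ B 1),
      kroneckerPairing ℚ ℚ B 1 x (loopClass ℚ ℚ (1 : ℚ) (Path.npow γ m)) =
        kroneckerPairing ℚ ℚ B 1 y (loopClass ℚ ℚ (1 : ℚ) (Path.npow γ m)) →
      kroneckerPairing ℚ ℚ B 1 x (loopClass ℚ ℚ (1 : ℚ) γ) =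
        kroneckerPairing ℚ ℚ B 1 y (loopClass ℚ ℚ (1 : ℚ) γ) := fun x y h ↦ by
    rw [loopClass_npow, map_nsmul, map_nsmul, ← Nat.cast_smul_eq_nsmul ℚ,
      ← Nat.cast_smul_eq_nsmul ℚ] at h
    exact smul_right_injective ℚ hmq h
  apply key
  set γ' := Path.npow γ m with hγ'
  -- Step 3: the right-hand side is `⟨a, h(N ∘ γ')⟩`; the left-hand side is `d • ⟨τ F^* a, h(γ')⟩`.
  rw [kroneckerPairing_map, map_loopClass, map_smul, LinearMap.smul_apply]
  -- Step 4: compute on a representing cocycle `φ` of `a`.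
  induction a using singularCohomology_induction_on with
  | h φ =>
    have hv : (ofPath γ').vertex 0 = b₀ := vertex_zero_ofPath γ'
    haveI : Fintype (proj ⁻¹' {(ofPath γ').vertex 0}) := (c.finite_fibre _).fintype
    -- `⟨τ F^*[φ], h(γ')⟩ = (1/d) ∑_{lifts σ̃ of γ'} φ(F ∘ σ̃) = (1/d) ∑_{e ∈ p⁻¹(b₀)} ⟨[φ], h(F ∘ λ_e)⟩`
    have hL : kroneckerPairing ℚ ℚ B 1 (c.transferMap (R := ℚ) 1 (singularCohomology.map ℚ ℚ F 1
        (singularCohomology.π ℚ ℚ G 1 φ))) (loopClass ℚ ℚ (1 : ℚ) γ') =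
        ((proj ⁻¹' {b₀}).ncard : ℚ)⁻¹ * ∑ e : proj ⁻¹' {b₀}, kroneckerPairing ℚ ℚ G 1
          (singularCohomology.π ℚ ℚ G 1 φ)
          (loopClass ℚ ℚ (1 : ℚ) ((c.liftedLoop γ' e (hcl e)).map F.continuous)) := by
      rw [singularCohomology.map_π, c.transferMap_π, kroneckerPairing_π_loopClass,
        c.iCocycles_transfer_map_apply, weight, Algebra.algebraMap_self, RingHom.id_apply,
        card_liftsFinset, c.sum_liftsFinset_eq_sum_fibre]
      congr 1
      · rw [hv]
      refine Fintype.sum_equiv (Equiv.subtypeEquivRight (fun x ↦ by rw [hv])) _ _ fun e ↦ ?_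
      rw [kroneckerPairing_π_loopClass, c.lift_ofPath_eq γ' ⟨e.1, by
          rw [Set.mem_preimage, Set.mem_singleton_iff]; exact (apply_eq_of_mem_fibre e).trans hv⟩ (hcl _)
        (apply_eq_of_mem_fibre e), ofPath_map]
      rfl
    rw [hL, smul_eq_mul, ← mul_assoc, mul_inv_cancel₀ hd, one_mul, ← map_sum,
      ← loopClass_finsetProd]
    -- the pointwise product of the loops `F ∘ λ_e` is the loop `N ∘ γ'`
    refine congrArg _ (loopClass_eq_of_ofPath_eq _ _ _ _ _ (ofPath_congr fun t ↦ ?_))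
    simp only [Path.finsetProd_apply, Path.map_coe, Function.comp_apply, liftedLoop_apply]
    exact c.prod_apply_liftLoop F γ' t

end Transfer

end IsFiniteCover

end Literature.AlgebraicTopology.SingularHomology

end
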